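import Literature.NumberTheory.EllipticCurves.WeierstrassAdditionProofs
import HarnessLib

/-!
# The coset lattice `ℤλ + 2Λ₀` of a half-lattice vector depends only on `℘(λ/2)` — stub 1
# `stub_halfLatticeUnique` of line `parities` on crux `StarGO2` (item stmt-BirchSwinnertonDyer-24444,
# route `EisensteinDepletionAtTwo`)

The registered stub (planner bsd-rank2-p2 GEN 25, skeleton `parities.lean`): for a period pair `L₀` and
`λ, λ' ∈ Λ₀ ∖ 2Λ₀` (i.e. `λ ∈ Λ₀`, `λ/2 ∉ Λ₀`) with `℘(λ/2) = ℘(λ'/2)`, the parity lattices agree: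
`z ∈ ℤλ + 2Λ₀ ↔ z ∈ ℤλ' + 2Λ₀` for every `z : ℂ`. Proof: `℘(u) = ℘(v)` for `u, v ∉ Λ₀` forces
`u + v ∈ Λ₀` or `u − v ∈ Λ₀` (tree theorem `PeriodPair.weierstrassP_eq_weierstrassP_iff`), so
`λ ≡ ∓λ' (mod 2Λ₀)`, and `kλ + 2w = (∓k)λ' + 2(w + k·(λ ± λ')/2)`.

HONEST FRAMING: a lattice bookkeeping lemma for the skeleton of an OPEN crux (the `2`-torsion point `λ/2`,
i.e. the value `℘(λ/2)`, determines the Kummer parity class, not the chosen representative `λ`); `StarGO2` is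
not proved by it; nothing reads an analytic rank; BSD is not proved by any of this.

References: J. V. Armitage, W. F. Eberlein, *Elliptic Functions*, LMS Student Texts 67 (2006; bib key 2001), §7.4 (7.63)
(values of `℘` on a period parallelogram) [ArmitageEberlein2001]; J. Silverman, AEC VI.3 [SilvermanAEC2009].
-/

set_option linter.dupNamespace false
set_option autoImplicit false

noncomputable section

namespace Summit.BirchSwinnertonDyer.BirchSwinnertonDyer.Theorems.DepletionAtTwo

section HalfLattice

variable {L₀ : PeriodPair}

/-- Transfer of the parity lattice along `μ ≡ μ' (mod 2Λ₀)`, written as `μ/2 − μ'/2 ∈ Λ₀`: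
`kμ + 2w = kμ' + 2(w + k(μ/2 − μ'/2))`. [folklore] -/
theorem parityLattice_of_half_sub_mem {μ μ' : ℂ} (hu : μ / 2 - μ' / 2 ∈ L₀.lattice) {z : ℂ}
    (hz : ∃ k : ℤ, ∃ w ∈ L₀.lattice, z = (k : ℂ) * μ + 2 * w) :
    ∃ k : ℤ, ∃ w ∈ L₀.lattice, z = (k : ℂ) * μ' + 2 * w := by
  obtain ⟨k, w, hw, rfl⟩ := hz
  refine ⟨k, w + (k : ℂ) * (μ / 2 - μ' / 2), ?_, by ring⟩
  have hk : (k : ℂ) * (μ / 2 - μ' / 2) = k • (μ / 2 - μ' / 2) := (zsmul_eq_mul _ k).symm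
  rw [hk]
  exact add_mem hw (L₀.lattice.smul_mem k hu)

/-- Transfer of the parity lattice along `μ ≡ −μ' (mod 2Λ₀)`, written as `μ/2 + μ'/2 ∈ Λ₀`:
`kμ + 2w = (−k)μ' + 2(w + k(μ/2 + μ'/2))`. [folklore] -/
theorem parityLattice_of_half_add_mem {μ μ' : ℂ} (hu : μ / 2 + μ' / 2 ∈ L₀.lattice) {z : ℂ}
    (hz : ∃ k : ℤ, ∃ w ∈ L₀.lattice, z = (k : ℂ) * μ + 2 * w) :
    ∃ k : ℤ, ∃ w ∈ L₀.lattice, z = (k : ℂ) * μ' + 2 * w := by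
  obtain ⟨k, w, hw, rfl⟩ := hz
  refine ⟨-k, w + (k : ℂ) * (μ / 2 + μ' / 2), ?_, by push_cast; ring⟩
  have hk : (k : ℂ) * (μ / 2 + μ' / 2) = k • (μ / 2 + μ' / 2) := (zsmul_eq_mul _ k).symm
  rw [hk]
  exact add_mem hw (L₀.lattice.smul_mem k hu)

end HalfLattice

/-- **Stub 1 `stub_halfLatticeUnique` of line `parities` (crux `StarGO2`, stmt-BirchSwinnertonDyer-24444),
verbatim:** the parity lattice `ℤλ + 2Λ₀` depends only on `℘(λ/2)` for `λ ∈ Λ₀ ∖ 2Λ₀`.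
[cite: ArmitageEberlein2001, §7.4 eq. (7.63)] [cite: SilvermanAEC2009, VI.3] -/
theorem stub_halfLatticeUnique :
    ∀ (L₀ : PeriodPair) (lam lam' : ℂ), lam ∈ L₀.lattice → lam / 2 ∉ L₀.lattice → lam' ∈ L₀.lattice →
      lam' / 2 ∉ L₀.lattice → L₀.weierstrassP (lam / 2) = L₀.weierstrassP (lam' / 2) →
      ∀ z : ℂ, (∃ k : ℤ, ∃ w ∈ L₀.lattice, z = (k : ℂ) * lam + 2 * w) ↔
        (∃ k : ℤ, ∃ w ∈ L₀.lattice, z = (k : ℂ) * lam' + 2 * w) := by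
  intro L₀ lam lam' _ hlam2 _ hlam'2 hP z
  rcases (L₀.weierstrassP_eq_weierstrassP_iff hlam2 hlam'2).mp hP with h | h
  · -- `λ/2 + λ'/2 ∈ Λ₀`
    have h' : lam' / 2 + lam / 2 ∈ L₀.lattice := by rwa [add_comm]
    exact ⟨parityLattice_of_half_add_mem h, parityLattice_of_half_add_mem h'⟩
  · -- `λ/2 − λ'/2 ∈ Λ₀`
    have h' : lam' / 2 - lam / 2 ∈ L₀.lattice := by
      have := neg_mem h
      rwa [neg_sub] at this
    exact ⟨parityLattice_of_half_sub_mem h, parityLattice_of_half_sub_mem h'⟩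

end Summit.BirchSwinnertonDyer.BirchSwinnertonDyer.Theorems.DepletionAtTwo

end
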